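import Summits.AnomalousDissipation.AnomalousDissipation.Theorems.TaylorCertificatesFloorCertificateStubMinimaxAlternative
import Summits.AnomalousDissipation.AnomalousDissipation.Theorems.TaylorCertificatesFloorCertificateStubPenalisationLimit

/-!
# Stub `stub_budgetDuality` (G) of the line `Sketch`
# (crux stmt-AnomalousDissipation-14086, `TaylorCertificates.FloorCertificateEnsembleCeiling`)

STRONG DUALITY WITH A STATE-DEPENDENT BUDGET, given the sibling line's S0 (lsc of the mean
enstrophy on `ProbabilityMeasure H`), S1 (compact dissipation sublevel sets of ball-carried
probability measures), S2 (Ky Fan's convex-like minimax principle) and S3a (linear combinations of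
cylindrical tests realised on a ball), taken as hypotheses in the shapes of the sibling line
`dissipation-deficit-duality` (crux `TaylorCertificates.FloorCertificate`). For `ν > 0`, smooth
`f`, a CONTINUOUS budget `g : H → ℝ` with `|g u| ≤ K(1 + |u|²)` and `η > 0`: if every RELAXED
stationary statistic `μ` of `NS_ν(f)` on the Leray ball `{|u|² ≤ ρ}`, `ρ = 16‖f‖²/ν²`, has
`∫ g dμ + η ≤ ε(μ)`, then some cylindrical `Φ` and `θ ≤ 0` certify
`g(u) − η ≤ ν‖∇u‖² + ⟨F(u),Φ'(u)⟩ + 2θ((u,f) − ν‖∇u‖²)` at every finite-enstrophy ball state.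
Proof = the sibling `…StubMinimaxAlternative(Tools)`, `…StubPenalisationLimit` and the composition
`FloorCertificate_of` with the pay-off `ε(μ) + ∫⟨F,Φ'⟩dμ + 2θ(∫(u,f)dμ − ε(μ)) − ∫ g dμ`: the budget
term is AFFINE in `μ` along mixtures (`fan_convex`), CONTINUOUS on ball-carried probability
measures (`continuous_integral_of_ball`) and independent of the multiplier, so Fan's hypotheses
survive. If no certificate exists, STEP 1 (`approxRelaxed`: Ky Fan below an enstrophy cut; a
beating multiplier would certify `g − η` by Dirac masses and `tail_estimate`) gives for each
slope `n` an `(n, −η)`-approximately relaxed statistic with budget, and STEP 2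
(`penalisationLimit`: cluster point in a compact sublevel set; `scaled_generator_le`,
`energy_defect_le`, lsc of `ε`, continuity of the clipped budget mean) an exact relaxed statistic
with `ε(μ) ≤ ∫ g dμ − η`, absurd. References: Ky Fan, PNAS 39 (1953) 42–47, Thm 2;
Foias–Manley–Rosa–Temam, *Navier–Stokes Equations and Turbulence* (2001), Ch. IV §1.2.
-/

noncomputable section

set_option linter.dupNamespace false

namespace Summit.AnomalousDissipation.AnomalousDissipation.Theorems.TaylorCertificatesFloorCertificateEnsembleCeiling

open MeasureTheory Filter Topology
open scoped ENNReal BoundedContinuousFunction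
open Literature.Analysis.FunctionSpaces Literature.Analysis.FluidPDE
open Summit.AnomalousDissipation.AnomalousDissipation.Theorems.TaylorCertificatesFloorCertificate
open Summit.AnomalousDissipation.AnomalousDissipation.Theorems.TaylorCertificatesFloorCertificate.PenalisationLimit
open Summit.AnomalousDissipation.AnomalousDissipation.Theorems.FloorCertificate.Negative

/-- Local notation: real vector fields on `T³`. -/
local notation "Vec3" => (UnitAddTorus (Fin 3)) → (EuclideanSpace ℝ (Fin 3))
/-- Local notation: `L²(T³; ℝ³)`. -/
local notation "L2" => (Lp (EuclideanSpace ℝ (Fin 3)) 2 (volume : Measure (UnitAddTorus (Fin 3))))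
/-- Local notation: the energy space `H`. -/
local notation "H3" => (Torus.energySpace (Fin 3))
/-- Local notation: Borel probability measures on `H` (topology of weak convergence). -/
local notation "PH" => (ProbabilityMeasure (Torus.energySpace (Fin 3)))
/-- Local notation (pure syntax): the Lagrangian `ε(μ) + ∫⟨F,Φ'⟩dμ + 2θ(∫(u,f)dμ − ε(μ))` of the
sibling line, written out verbatim. -/
local notation "Lag⟪" ν ", " f ", " Φ ", " θ ", " μ "⟫" =>
  (Torus.ensembleDissipation ν μ +
    ∫ u, Torus.nsGeneratorPairing ν f u (Torus.CylindricalTest.grad Φ u) ∂μ +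
    2 * θ * ((∫ u, Torus.pairing (Subtype.val u) f ∂μ) - Torus.ensembleDissipation ν μ))

namespace BudgetDuality

/-- A budget of quadratic growth `|g u| ≤ K(1 + |u|²)` is bounded by `K(1 + ρ)` on the ball
`{|u|² ≤ ρ}` (note `K ≥ |g 0| ≥ 0`). [folklore] -/
theorem budget_le_on_ball {g : H3 → ℝ} {K : ℝ} (hK : ∀ u : H3, |g u| ≤ K * (1 + ‖u‖ ^ 2)) (ρ : ℝ)
    (u : H3) (hu : ‖u‖ ^ 2 ≤ ρ) : |g u| ≤ K * (1 + ρ) := by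
  have h0 := hK 0
  rw [norm_zero, zero_pow two_ne_zero, add_zero, mul_one] at h0
  exact (hK u).trans (mul_le_mul_of_nonneg_left (by linarith) ((abs_nonneg _).trans h0))

/-- **Convex-likeness in the measure, budget version**: the mixture `t μ₁ + (1 − t) μ₂` of two
probability measures carried by the ball with mean enstrophy `≤ C` is again such a measure, and the
budget pay-off `Lagrangian − ∫ g dμ` is AFFINE along it (Fan 1953, Thm 2 (ii)). [folklore] -/
theorem fan_convex {ν : ℝ} {f : Vec3} (hf : MemLp f 2 volume) {g : H3 → ℝ} (hg : Continuous g)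
    {K : ℝ} (hK : ∀ u : H3, |g u| ≤ K * (1 + ‖u‖ ^ 2)) (ρ : ℝ) {C : ℝ≥0∞} (hC : C ≠ ⊤) (μ₁ μ₂ : PH)
    (h₁ : (∀ᵐ u ∂(μ₁ : Measure H3), ‖u‖ ^ 2 ≤ ρ) ∧ Torus.ensembleEnstrophy (μ₁ : Measure H3) ≤ C)
    (h₂ : (∀ᵐ u ∂(μ₂ : Measure H3), ‖u‖ ^ 2 ≤ ρ) ∧ Torus.ensembleEnstrophy (μ₂ : Measure H3) ≤ C)
    {t : ℝ} (ht0 : 0 ≤ t) (ht1 : t ≤ 1) :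
    ∃ μ₀ : PH, ((∀ᵐ u ∂(μ₀ : Measure H3), ‖u‖ ^ 2 ≤ ρ) ∧ Torus.ensembleEnstrophy (μ₀ : Measure H3) ≤ C) ∧
      ∀ (Φ : Torus.CylindricalTest (Fin 3)) (θ : ℝ),
        Lag⟪ν, f, Φ, θ, (μ₀ : Measure H3)⟫ + -∫ u, g u ∂(μ₀ : Measure H3) =
          t * (Lag⟪ν, f, Φ, θ, (μ₁ : Measure H3)⟫ + -∫ u, g u ∂(μ₁ : Measure H3)) +
            (1 - t) * (Lag⟪ν, f, Φ, θ, (μ₂ : Measure H3)⟫ + -∫ u, g u ∂(μ₂ : Measure H3)) := by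
  set m : Measure H3 := ENNReal.ofReal t • (μ₁ : Measure H3) + ENNReal.ofReal (1 - t) • (μ₂ : Measure H3)
  have hprob : IsProbabilityMeasure m := isProbabilityMeasure_mix _ _ ht0 ht1
  have hE : Torus.ensembleEnstrophy m = ENNReal.ofReal t * Torus.ensembleEnstrophy (μ₁ : Measure H3) +
      ENNReal.ofReal (1 - t) * Torus.ensembleEnstrophy (μ₂ : Measure H3) := lintegral_mix _ _ _ _ _
  have hE₁ : Torus.ensembleEnstrophy (μ₁ : Measure H3) ≠ ⊤ := ne_top_of_le_ne_top hC h₁.2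
  have hE₂ : Torus.ensembleEnstrophy (μ₂ : Measure H3) ≠ ⊤ := ne_top_of_le_ne_top hC h₂.2
  refine ⟨⟨m, hprob⟩, ⟨ae_mix _ _ h₁.1 h₂.1, ?_⟩, fun Φ θ => ?_⟩
  · rw [ProbabilityMeasure.coe_mk, hE]
    exact mix_le ht0 ht1 h₁.2 h₂.2
  · obtain ⟨K₁, hK₁⟩ := abs_nsGeneratorPairing_grad_growth ν hf Φ
    have hcg := Torus.continuous_nsGeneratorPairing_grad ν (hf.integrable one_le_two) Φ
    have hG : ∫ u, Torus.nsGeneratorPairing ν f u (Φ.grad u) ∂m =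
        t * ∫ u, Torus.nsGeneratorPairing ν f u (Φ.grad u) ∂(μ₁ : Measure H3) +
          (1 - t) * ∫ u, Torus.nsGeneratorPairing ν f u (Φ.grad u) ∂(μ₂ : Measure H3) :=
      integral_mix _ _ ht0 ht1 (integrable_of_ball hcg hK₁ _ h₁.1) (integrable_of_ball hcg hK₁ _ h₂.1)
    have hW : ∫ u, Torus.pairing u.1 f ∂m = t * ∫ u, Torus.pairing u.1 f ∂(μ₁ : Measure H3) +
        (1 - t) * ∫ u, Torus.pairing u.1 f ∂(μ₂ : Measure H3) :=
      integral_mix _ _ ht0 ht1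
        (integrable_of_ball (Torus.continuous_pairing_coe hf) (abs_pairing_growth hf) _ h₁.1)
        (integrable_of_ball (Torus.continuous_pairing_coe hf) (abs_pairing_growth hf) _ h₂.1)
    have hB : ∫ u, g u ∂m = t * ∫ u, g u ∂(μ₁ : Measure H3) + (1 - t) * ∫ u, g u ∂(μ₂ : Measure H3) :=
      integral_mix _ _ ht0 ht1 (integrable_of_ball hg hK _ h₁.1) (integrable_of_ball hg hK _ h₂.1)
    simp only [ProbabilityMeasure.coe_mk, Torus.ensembleDissipation]
    rw [hE, toReal_mix ht0 ht1 hE₁ hE₂, hG, hW, hB]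
    ring

section Steps
variable (hS0 : LowerSemicontinuous fun μ : PH => Torus.ensembleEnstrophy (μ : Measure H3))
  (hS1 : ∀ (ρ : ℝ) (c : ℝ≥0∞), c ≠ ⊤ → IsCompact {μ : PH |
    (∀ᵐ u ∂(μ : Measure H3), ‖u‖ ^ 2 ≤ ρ) ∧ Torus.ensembleEnstrophy (μ : Measure H3) ≤ c})
  (hS2 : ∀ (X Y : Type) [TopologicalSpace X] [CompactSpace X] [Nonempty Y] (φ : X → Y → ℝ),
    (∀ y : Y, LowerSemicontinuous fun x : X => φ x y) →
    (∀ (x₁ x₂ : X) (t : ℝ), 0 ≤ t → t ≤ 1 → ∃ x₀ : X, ∀ y : Y, φ x₀ y ≤ t * φ x₁ y + (1 - t) * φ x₂ y) →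
    (∀ (y₁ y₂ : Y) (t : ℝ), 0 ≤ t → t ≤ 1 → ∃ y₀ : Y, ∀ x : X, t * φ x y₁ + (1 - t) * φ x y₂ ≤ φ x y₀) →
    ∀ γ : ℝ, (∀ x : X, ∃ y : Y, γ < φ x y) → ∃ y : Y, ∀ x : X, γ < φ x y)
  (hS3a : ∀ (ρ a b : ℝ) (Φ₁ Φ₂ : Torus.CylindricalTest (Fin 3)), ∃ Φ₀ : Torus.CylindricalTest (Fin 3),
    ∀ u : H3, ‖u‖ ^ 2 ≤ ρ → Φ₀.grad u = a • Φ₁.grad u + b • Φ₂.grad u)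
  {ν : ℝ} (hν : 0 < ν) {f : Vec3} (hfs : Torus.IsSmooth f) {g : H3 → ℝ} (hg : Continuous g) {K : ℝ}
  (hK : ∀ u : H3, |g u| ≤ K * (1 + ‖u‖ ^ 2)) (η : ℝ)

include hS0 hS1 hS3a hν hfs hg hK
include hS2 in
/-- STEP 1 (the minimax alternative with budget at slope `n` and level `−η`, first horn excluded):
if no `(Φ, θ ≤ 0)` certifies `g − η` on the finite-enstrophy states of the Leray ball, an
`(n, −η)`-approximately relaxed statistic with budget exists (a probability measure carried by the
ball, of finite mean enstrophy, with Lagrangian `≤ ∫ g dμ − η` against every slope-`n` multiplier). -/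
theorem approxRelaxed (n : ℕ)
    (hno : ¬ ∃ (Φ : Torus.CylindricalTest (Fin 3)) (θ : ℝ), θ ≤ 0 ∧
      ∀ u : H3, Torus.eGradNormSq (u.1 : Vec3) ≠ ⊤ → ‖u‖ ^ 2 ≤ 16 * (∫ x, ‖f x‖ ^ 2) / ν ^ 2 →
        g u - η ≤ ν * (Torus.eGradNormSq (u.1 : Vec3)).toReal + Torus.nsGeneratorPairing ν f u (Φ.grad u) +
          2 * θ * (Torus.pairing u.1 f - ν * (Torus.eGradNormSq (u.1 : Vec3)).toReal)) :
    ∃ μ : PH, (∀ᵐ u ∂(μ : Measure H3), ‖u‖ ^ 2 ≤ 16 * (∫ x, ‖f x‖ ^ 2) / ν ^ 2) ∧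
      Torus.ensembleEnstrophy (μ : Measure H3) < ⊤ ∧
      ∀ (Φ : Torus.CylindricalTest (Fin 3)) (θ : ℝ), -(n : ℝ) ≤ θ → θ ≤ 0 →
        (∀ u : H3, ‖u‖ ^ 2 ≤ 16 * (∫ x, ‖f x‖ ^ 2) / ν ^ 2 → |Torus.nsGeneratorPairing ν f u (Φ.grad u)| ≤ n) →
        Lag⟪ν, f, Φ, θ, (μ : Measure H3)⟫ ≤ (∫ u, g u ∂(μ : Measure H3)) + -η := by
  have hf : MemLp f 2 volume := hfs.memLp 2
  set ρ : ℝ := 16 * (∫ x, ‖f x‖ ^ 2) / ν ^ 2 with hρ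
  obtain ⟨Φz, hΦz⟩ := exists_flat_test
  have hz : ∀ u : H3, Torus.nsGeneratorPairing ν f u (Φz.grad u) = 0 := hΦz ν f hfs.integrable
  by_contra hnoB
  have hL : (0 : ℝ) ≤ n := Nat.cast_nonneg n
  -- the enstrophy cut `c` and the game set `X = {μ : |u|² ≤ ρ a.e., ∫⁻‖∇u‖² ≤ c/ν}`
  obtain ⟨c, hcle⟩ : ∃ c : ℝ,
      (n : ℝ) * (1 + 2 * (Real.sqrt ρ * ‖hf.toLp f‖)) + (K * (1 + ρ) + |(-η)|) + 1 ≤ c := ⟨_, le_rfl⟩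
  have hC : ENNReal.ofReal (c / ν) ≠ ⊤ := ENNReal.ofReal_ne_top
  set S : Set PH := {μ : PH | (∀ᵐ u ∂(μ : Measure H3), ‖u‖ ^ 2 ≤ ρ) ∧
    Torus.ensembleEnstrophy (μ : Measure H3) ≤ ENNReal.ofReal (c / ν)} with hS
  have hmem : ∀ x : S, (∀ᵐ u ∂((x : PH) : Measure H3), ‖u‖ ^ 2 ≤ ρ) ∧
      Torus.ensembleEnstrophy ((x : PH) : Measure H3) ≤ ENNReal.ofReal (c / ν) := fun x => by
    simpa only [hS, Set.mem_setOf_eq] using x.2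
  haveI : CompactSpace S := isCompact_iff_compactSpace.1 (hS1 ρ _ hC)
  haveI : Nonempty {p : Torus.CylindricalTest (Fin 3) × ℝ // -(n : ℝ) ≤ p.2 ∧ p.2 ≤ 0 ∧
      ∀ u : H3, ‖u‖ ^ 2 ≤ ρ → |Torus.nsGeneratorPairing ν f u (p.1.grad u)| ≤ n} :=
    ⟨⟨(Φz, 0), by linarith, le_rfl, fun u _ => by rw [hz u, abs_zero]; exact hL⟩⟩
  -- every `μ ∈ X` is beaten above `−η` (else `μ` is approximately relaxed with budget)
  have hpt : ∀ μ : PH, μ ∈ S → ∃ (Φ : Torus.CylindricalTest (Fin 3)) (θ : ℝ),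
      (-(n : ℝ) ≤ θ ∧ θ ≤ 0 ∧ ∀ u : H3, ‖u‖ ^ 2 ≤ ρ → |Torus.nsGeneratorPairing ν f u (Φ.grad u)| ≤ n) ∧
      -η < Lag⟪ν, f, Φ, θ, (μ : Measure H3)⟫ + -∫ u, g u ∂(μ : Measure H3) := by
    intro μ hμ
    have hμ' := hmem ⟨μ, hμ⟩
    by_contra hcon
    push Not at hcon
    exact hnoB ⟨μ, hμ'.1, lt_of_le_of_lt hμ'.2 hC.lt_top, fun Φ θ h1 h2 h3 => by
      have h := hcon Φ θ ⟨h1, h2, h3⟩; linarith⟩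
  -- Ky Fan (S2): one slope-`n` multiplier beats all of `X` above `−η`
  obtain ⟨y₀, hy₀⟩ := hS2 S _
    (fun (x : S) (y : {p : Torus.CylindricalTest (Fin 3) × ℝ // -(n : ℝ) ≤ p.2 ∧ p.2 ≤ 0 ∧
        ∀ u : H3, ‖u‖ ^ 2 ≤ ρ → |Torus.nsGeneratorPairing ν f u (p.1.grad u)| ≤ n}) =>
      Lag⟪ν, f, y.1.1, y.1.2, ((x : PH) : Measure H3)⟫ + -∫ u, g u ∂((x : PH) : Measure H3))
    (fun y => (lagrangian_lowerSemicontinuous hS0 hν hf ρ hC y.1.1 y.2.2.1).add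
      (continuous_integral_of_ball hg hK (S := S) fun μ hμ => (hmem ⟨μ, hμ⟩).1).neg.lowerSemicontinuous)
    (fun x₁ x₂ t ht0 ht1 => by
      obtain ⟨μ₀, hμ₀, hLag⟩ := fan_convex (ν := ν) hf hg hK ρ hC x₁.1 x₂.1 (hmem x₁) (hmem x₂) ht0 ht1
      exact ⟨⟨μ₀, hμ₀⟩, fun y => (hLag y.1.1 y.1.2).le⟩)
    (fun y₁ y₂ t ht0 ht1 => by
      obtain ⟨Φ₀, θ₀, hy, hLag⟩ := fan_concave hS3a ν hf ρ y₁.2 y₂.2 ht0 ht1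
      have key : ∀ x : S,
          t * (Lag⟪ν, f, y₁.1.1, y₁.1.2, ((x : PH) : Measure H3)⟫ + -∫ u, g u ∂((x : PH) : Measure H3)) +
            (1 - t) * (Lag⟪ν, f, y₂.1.1, y₂.1.2, ((x : PH) : Measure H3)⟫ +
              -∫ u, g u ∂((x : PH) : Measure H3)) ≤
            Lag⟪ν, f, Φ₀, θ₀, ((x : PH) : Measure H3)⟫ + -∫ u, g u ∂((x : PH) : Measure H3) := by
        intro x
        rw [hLag _ inferInstance (hmem x).1]
        exact le_of_eq (by ring)
      exact ⟨⟨(Φ₀, θ₀), hy⟩, key⟩)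
    (-η)
    (fun x => by
      obtain ⟨Φ, θ, hy, hlt⟩ := hpt x.1 x.2
      exact ⟨⟨(Φ, θ), hy⟩, hlt⟩)
  -- this multiplier certifies `g − η` at every finite-enstrophy ball state: excluded by `hno`
  refine hno ⟨y₀.1.1, y₀.1.2, y₀.2.2.1, fun u hfin hball => ?_⟩
  rcases le_or_gt (ν * (Torus.eGradNormSq (u.1 : Vec3)).toReal) c with hle | hlt
  · -- the Dirac mass `δ_u` lies in `X`
    have hE : Torus.ensembleEnstrophy (Measure.dirac u) ≤ ENNReal.ofReal (c / ν) := by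
      rw [ensembleEnstrophy_dirac, ← ENNReal.ofReal_toReal hfin]
      exact ENNReal.ofReal_le_ofReal (by rw [le_div_iff₀ hν, mul_comm]; exact hle)
    have h := hy₀ ⟨⟨Measure.dirac u, inferInstance⟩,
      show (⟨Measure.dirac u, inferInstance⟩ : PH) ∈ S from ⟨ae_dirac_of hball, hE⟩⟩
    haveI := measurableSingletonClass_energySpace
    simp only [ProbabilityMeasure.coe_mk] at h
    rw [lagrangian_dirac, integral_dirac] at h
    linarith
  · -- the tail `ν‖∇u‖² > c` pays by itself
    have h1 := abs_add_le (g u) (-η)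
    have h2 := budget_le_on_ball hK ρ u hball
    have htail := tail_estimate (γ := g u + -η) hL le_rfl y₀.2.1 y₀.2.2.1 (y₀.2.2.2 u hball)
      (abs_pairing_le_of_ball hf hball) (by positivity) hlt (by linarith)
    linarith

/-- STEP 2 (the penalisation limit with budget): from `(n, −η)`-approximately relaxed statistics
with budget for every `n`, an EXACT relaxed stationary statistic `μ` with `ε(μ) ≤ ∫ g dμ − η`
(cluster point in a compact sublevel set of S1; Liouville by `scaled_generator_le`, energy by
`energy_defect_le` and the lsc of `ε` (S0), budget by continuity of the clipped budget mean). -/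
theorem penalisationLimit (μs : ℕ → PH)
    (hμs : ∀ n : ℕ, (∀ᵐ u ∂(μs n : Measure H3), ‖u‖ ^ 2 ≤ 16 * (∫ x, ‖f x‖ ^ 2) / ν ^ 2) ∧
      Torus.ensembleEnstrophy (μs n : Measure H3) < ⊤ ∧
      ∀ (Φ : Torus.CylindricalTest (Fin 3)) (θ : ℝ), -(n : ℝ) ≤ θ → θ ≤ 0 →
        (∀ u : H3, ‖u‖ ^ 2 ≤ 16 * (∫ x, ‖f x‖ ^ 2) / ν ^ 2 → |Torus.nsGeneratorPairing ν f u (Φ.grad u)| ≤ n) →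
        Lag⟪ν, f, Φ, θ, (μs n : Measure H3)⟫ ≤ (∫ u, g u ∂(μs n : Measure H3)) + -η) :
    ∃ μ : PH, (∀ᵐ u ∂(μ : Measure H3), ‖u‖ ^ 2 ≤ 16 * (∫ x, ‖f x‖ ^ 2) / ν ^ 2) ∧
      Torus.ensembleEnstrophy (μ : Measure H3) < ⊤ ∧
      (∀ Φ : Torus.CylindricalTest (Fin 3),
        Integrable (fun u => Torus.nsGeneratorPairing ν f u (Φ.grad u)) (μ : Measure H3) ∧
          ∫ u, Torus.nsGeneratorPairing ν f u (Φ.grad u) ∂(μ : Measure H3) = 0) ∧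
      Integrable (fun u : H3 => Torus.pairing u.1 f) (μ : Measure H3) ∧
      Torus.ensembleDissipation ν (μ : Measure H3) ≤ ∫ u, Torus.pairing u.1 f ∂(μ : Measure H3) ∧
      Torus.ensembleDissipation ν (μ : Measure H3) ≤ (∫ u, g u ∂(μ : Measure H3)) + -η := by
  have hf : MemLp f 2 volume := hfs.memLp 2
  set ρ : ℝ := 16 * (∫ x, ‖f x‖ ^ 2) / ν ^ 2 with hρ
  have hKb : ∀ u : H3, ‖u‖ ^ 2 ≤ ρ → |g u| ≤ K * (1 + ρ) := budget_le_on_ball hK ρ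
  obtain ⟨Φz, hΦz⟩ := exists_flat_test
  have hz : ∀ u : H3, Torus.nsGeneratorPairing ν f u (Φz.grad u) = 0 := hΦz ν f hfs.integrable
  have hDnonneg : ∀ μ' : Measure H3, 0 ≤ Torus.ensembleDissipation ν μ' :=
    fun μ' => mul_nonneg hν.le ENNReal.toReal_nonneg
  -- the budget means are `≤ K(1 + ρ)`; `ε(μₙ) ≤ ∫ g dμₙ − η` (flat test) `≤ M♭ := K(1 + ρ) − η`
  have hGle : ∀ n, ∫ u, g u ∂(μs n : Measure H3) ≤ K * (1 + ρ) := fun n => by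
    have h1 := integral_mono_ae (integrable_of_ball hg hK _ (hμs n).1) (integrable_const _)
      (((hμs n).1).mono fun u hu => (le_abs_self _).trans (hKb u hu))
    simpa using h1
  have hDle : ∀ n, Torus.ensembleDissipation ν (μs n : Measure H3) ≤
      (∫ u, g u ∂(μs n : Measure H3)) + -η := fun n => by
    have h := (hμs n).2.2 Φz 0 (neg_nonpos.2 (Nat.cast_nonneg n)) le_rfl
      fun u _ => by rw [hz u, abs_zero]; exact Nat.cast_nonneg n
    have hIz : ∫ u, Torus.nsGeneratorPairing ν f u (Φz.grad u) ∂(μs n : Measure H3) = 0 := by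
      simp only [hz, integral_zero]
    rw [hIz] at h
    linarith
  set Mb : ℝ := K * (1 + ρ) + -η with hMb
  have hDn : ∀ n, Torus.ensembleDissipation ν (μs n : Measure H3) ≤ Mb := fun n =>
    (hDle n).trans (by linarith [hGle n])
  have hM : 0 ≤ Mb := (hDnonneg _).trans (hDn 0)
  -- the compact sublevel set `X` of S1 at enstrophy level `M♭/ν`; a cluster point and its filter
  set cE : ℝ≥0∞ := ENNReal.ofReal (Mb / ν)
  have hcν : 0 ≤ Mb / ν := div_nonneg hM hν.le
  have hEn : ∀ n, Torus.ensembleEnstrophy (μs n : Measure H3) ≤ cE := fun n => by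
    refine (ENNReal.le_ofReal_iff_toReal_le (hμs n).2.1.ne hcν).2 ?_
    rw [le_div_iff₀' hν]
    exact hDn n
  set X : Set PH :=
    {μ | (∀ᵐ u ∂(μ : Measure H3), ‖u‖ ^ 2 ≤ ρ) ∧ Torus.ensembleEnstrophy (μ : Measure H3) ≤ cE}
  have hX : IsCompact X := hS1 ρ cE ENNReal.ofReal_ne_top
  have hPS : ∀ n, μs n ∈ X := fun n => ⟨(hμs n).1, hEn n⟩
  obtain ⟨μ, hμX, hcl⟩ := hX.exists_clusterPt (f := map μs atTop)
    (le_principal_iff.2 (mem_map.2 (univ_mem' hPS)))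
  set 𝓕 : Filter PH := 𝓝 μ ⊓ map μs atTop
  haveI h𝓕ne : 𝓕.NeBot := hcl.neBot
  have hT : ∀ gb : H3 →ᵇ ℝ, Tendsto (fun μ' : PH => ∫ u, gb u ∂(μ' : Measure H3)) 𝓕
      (𝓝 (∫ u, gb u ∂(μ : Measure H3))) := fun gb =>
    ProbabilityMeasure.tendsto_iff_forall_integral_tendsto.1 (tendsto_id'.2 inf_le_left) gb
  have hev : ∀ {p : PH → Prop} (N : ℕ), (∀ n, N ≤ n → p (μs n)) → ∀ᶠ μ' in 𝓕, p μ' :=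
    fun N hp => (show ∀ᶠ μ' in map μs atTop, _ from
      eventually_map.2 (eventually_atTop.2 ⟨N, hp⟩)).filter_mono inf_le_right
  have hμball : ∀ᵐ u ∂(μ : Measure H3), ‖u‖ ^ 2 ≤ ρ := hμX.1
  have hμE : Torus.ensembleEnstrophy (μ : Measure H3) ≤ cE := hμX.2
  have hμfin : Torus.ensembleEnstrophy (μ : Measure H3) < ⊤ := hμE.trans_lt ENNReal.ofReal_lt_top
  -- (ii) the Liouville identity
  have hLiou : ∀ Φ : Torus.CylindricalTest (Fin 3),
      Integrable (fun u => Torus.nsGeneratorPairing ν f u (Φ.grad u)) (μ : Measure H3) ∧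
        ∫ u, Torus.nsGeneratorPairing ν f u (Φ.grad u) ∂(μ : Measure H3) = 0 := by
    intro Φ
    obtain ⟨K₁, hK₁0, hK₁⟩ := Torus.exists_abs_nsGeneratorPairing_grad_le ν hf Φ
    have hC : ∀ u : H3, ‖u‖ ^ 2 ≤ ρ → |Torus.nsGeneratorPairing ν f u (Φ.grad u)| ≤ K₁ * (1 + ρ) :=
      fun u hu => (hK₁ u).trans (mul_le_mul_of_nonneg_left (by linarith) hK₁0)
    obtain ⟨wg, hwg⟩ := exists_boundedContinuous_integral_eq
      (Torus.continuous_nsGeneratorPairing_grad ν hfs.integrable Φ) hC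
    have hIμ := hwg (μ : Measure H3) hμball
    refine ⟨hIμ.1, ?_⟩
    rw [hIμ.2]
    refine eq_zero_of_tendsto_of_abs_le (M := Mb) (hT wg) fun k hk => ?_
    obtain ⟨N, hN⟩ := exists_nat_ge (k * (K₁ * (1 + ρ)))
    refine hev N fun n hn => ?_
    rw [← (hwg _ (hμs n).1).2]
    have hkn : |k| * (K₁ * (1 + ρ)) ≤ (n : ℝ) := by rw [abs_of_pos hk]; exact hN.trans (by exact_mod_cast hn)
    have h1 := scaled_generator_le hfs hS3a (hμs n).1 (hDnonneg _) (hμs n).2.2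
      (Nat.cast_nonneg n) Φ hC hkn
    have h2 := scaled_generator_le hfs hS3a (hμs n).1 (hDnonneg _) (hμs n).2.2
      (Nat.cast_nonneg n) Φ hC (show |(-k)| * (K₁ * (1 + ρ)) ≤ (n : ℝ) by rwa [abs_neg])
    have h3 := hGle n
    rw [abs_le, neg_le, le_div_iff₀ hk, le_div_iff₀ hk]
    constructor <;> linarith
  -- (iii)/(iv) the work functional and the energy inequality
  obtain ⟨wb, hwb⟩ := exists_boundedContinuous_integral_eq (Torus.continuous_pairing_coe hf)
    fun u (hu : ‖u‖ ^ 2 ≤ ρ) => abs_pairing_le_of_ball hf hu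
  have hWμ := hwb (μ : Measure H3) hμball
  have hA : ∀ y < ENNReal.truncateToReal cE (Torus.ensembleEnstrophy (μ : Measure H3)),
      ∀ᶠ μ' : PH in 𝓕, y < ENNReal.truncateToReal cE (Torus.ensembleEnstrophy (μ' : Measure H3)) :=
    fun y hy => (((ENNReal.continuous_truncateToReal ENNReal.ofReal_ne_top).comp_lowerSemicontinuous
      hS0 (ENNReal.monotone_truncateToReal ENNReal.ofReal_ne_top) μ) y hy).filter_mono inf_le_left
  have hmain : ν * ENNReal.truncateToReal cE (Torus.ensembleEnstrophy (μ : Measure H3)) ≤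
      ∫ u, wb u ∂(μ : Measure H3) := by
    refine mul_le_of_lsc_of_tendsto (x₀ := μ) hν
      (A := fun μ' : PH => ENNReal.truncateToReal cE (Torus.ensembleEnstrophy (μ' : Measure H3)))
      (W := fun μ' : PH => ∫ u, wb u ∂(μ' : Measure H3)) hA (hT wb) fun ε hε => ?_
    obtain ⟨N, hN⟩ := exists_nat_ge (Mb / (2 * ε))
    have hN' : Mb ≤ (N : ℝ) * (2 * ε) := (div_le_iff₀ (by positivity)).1 hN
    refine hev (N + 1) fun n hn => ?_
    rw [ENNReal.truncateToReal_eq_toReal ENNReal.ofReal_ne_top (hPS n).2, ← (hwb _ (hμs n).1).2]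
    have hd := energy_defect_le hfs (hμs n).2.2 (Nat.cast_nonneg n)
    have hD0 := hDnonneg (μs n : Measure H3)
    have h3 := hGle n
    have hNn : (N : ℝ) * (2 * ε) ≤ (n : ℝ) * (2 * ε) :=
      mul_le_mul_of_nonneg_right (by exact_mod_cast (Nat.le_succ N).trans hn) (by positivity)
    have hn1 : (1 : ℝ) ≤ n := by exact_mod_cast (Nat.le_add_left 1 N).trans hn
    unfold Torus.ensembleDissipation at hd hD0
    refine not_lt.1 fun hcon => ?_
    have hprod := mul_lt_mul_of_pos_left hcon (by linarith : (0 : ℝ) < 2 * (n : ℝ))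
    linarith
  rw [ENNReal.truncateToReal_eq_toReal ENNReal.ofReal_ne_top hμE, ← hWμ.2] at hmain
  -- (v) the budget bound `ε(μ) ≤ ∫ g dμ − η` in the limit
  obtain ⟨gb, hgb⟩ := exists_boundedContinuous_integral_eq hg hKb
  have hGμ := hgb (μ : Measure H3) hμball
  have hbud : ν * ENNReal.truncateToReal cE (Torus.ensembleEnstrophy (μ : Measure H3)) ≤
      (∫ u, gb u ∂(μ : Measure H3)) + -η := by
    refine mul_le_of_lsc_of_tendsto (x₀ := μ) hν
      (A := fun μ' : PH => ENNReal.truncateToReal cE (Torus.ensembleEnstrophy (μ' : Measure H3)))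
      (W := fun μ' : PH => (∫ u, gb u ∂(μ' : Measure H3)) + -η) hA ((hT gb).add_const (-η))
      fun ε hε => hev 0 fun n _ => ?_
    rw [ENNReal.truncateToReal_eq_toReal ENNReal.ofReal_ne_top (hPS n).2, ← (hgb _ (hμs n).1).2]
    have hle := hDle n
    unfold Torus.ensembleDissipation at hle
    linarith
  rw [ENNReal.truncateToReal_eq_toReal ENNReal.ofReal_ne_top hμE, ← hGμ.2] at hbud
  exact ⟨μ, hμball, hμfin, hLiou, hWμ.1, hmain, hbud⟩

end Steps

end BudgetDuality

/-- **G `stub_budgetDuality`** — STRONG DUALITY WITH A STATE-DEPENDENT BUDGET, GIVEN THE SIBLING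
LINE's S0, S1, S2 (Ky Fan) and S3a. For `ν > 0`, smooth `f`, a continuous budget `g : H → ℝ` with
`|g u| ≤ K(1 + |u|²)` and `η > 0`: if every relaxed stationary statistic `μ` of `NS_ν(f)` on the
Leray ball has `∫ g dμ + η ≤ ε(μ)`, then some cylindrical `Φ` and `θ ≤ 0` certify
`g(u) − η ≤ ν‖∇u‖² + ⟨F(u),Φ'(u)⟩ + 2θ((u,f) − ν‖∇u‖²)` at every finite-enstrophy state of the ball
(`BudgetDuality.approxRelaxed` at every slope `n`, then `BudgetDuality.penalisationLimit`). -/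
theorem stub_budgetDuality :
    (LowerSemicontinuous fun μ : ProbabilityMeasure (Torus.energySpace (Fin 3)) =>
      Torus.ensembleEnstrophy (μ : Measure (Torus.energySpace (Fin 3)))) →
    (∀ (ρ : ℝ) (c : ℝ≥0∞), c ≠ ⊤ →
      IsCompact {μ : ProbabilityMeasure (Torus.energySpace (Fin 3)) |
        (∀ᵐ u ∂(μ : Measure (Torus.energySpace (Fin 3))), ‖u‖ ^ 2 ≤ ρ) ∧
          Torus.ensembleEnstrophy (μ : Measure (Torus.energySpace (Fin 3))) ≤ c}) →
    (∀ (X Y : Type) [TopologicalSpace X] [CompactSpace X] [Nonempty Y] (φ : X → Y → ℝ),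
      (∀ y : Y, LowerSemicontinuous fun x : X => φ x y) →
      (∀ (x₁ x₂ : X) (t : ℝ), 0 ≤ t → t ≤ 1 → ∃ x₀ : X, ∀ y : Y, φ x₀ y ≤ t * φ x₁ y + (1 - t) * φ x₂ y) →
      (∀ (y₁ y₂ : Y) (t : ℝ), 0 ≤ t → t ≤ 1 → ∃ y₀ : Y, ∀ x : X, t * φ x y₁ + (1 - t) * φ x y₂ ≤ φ x y₀) →
      ∀ γ : ℝ, (∀ x : X, ∃ y : Y, γ < φ x y) → ∃ y : Y, ∀ x : X, γ < φ x y) →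
    (∀ (ρ a b : ℝ) (Φ₁ Φ₂ : Torus.CylindricalTest (Fin 3)), ∃ Φ₀ : Torus.CylindricalTest (Fin 3),
      ∀ u : Torus.energySpace (Fin 3), ‖u‖ ^ 2 ≤ ρ → Φ₀.grad u = a • Φ₁.grad u + b • Φ₂.grad u) →
    ∀ (ν : ℝ) (f : Vec3), 0 < ν → Torus.IsSmooth f →
    ∀ (g : H3 → ℝ), Continuous g → (∃ K : ℝ, ∀ u : H3, |g u| ≤ K * (1 + ‖u‖ ^ 2)) →
    ∀ η : ℝ, 0 < η →
      (∀ μ : Measure H3,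
        IsProbabilityMeasure μ →
        (∀ᵐ u ∂μ, ‖u‖ ^ 2 ≤ 16 * (∫ x, ‖f x‖ ^ 2) / ν ^ 2) →
        Torus.ensembleEnstrophy μ < ⊤ →
        (∀ Φ : Torus.CylindricalTest (Fin 3),
          Integrable (fun u => Torus.nsGeneratorPairing ν f u (Φ.grad u)) μ ∧
            ∫ u, Torus.nsGeneratorPairing ν f u (Φ.grad u) ∂μ = 0) →
        Integrable (fun u : H3 => Torus.pairing (u : L2) f) μ →
        Torus.ensembleDissipation ν μ ≤ ∫ u, Torus.pairing (u : L2) f ∂μ →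
        (∫ u, g u ∂μ) + η ≤ Torus.ensembleDissipation ν μ) →
      ∃ (Φ : Torus.CylindricalTest (Fin 3)) (θ : ℝ), θ ≤ 0 ∧
        ∀ u : H3, Torus.eGradNormSq ((u : L2) : Vec3) ≠ ⊤ → ‖u‖ ^ 2 ≤ 16 * (∫ x, ‖f x‖ ^ 2) / ν ^ 2 →
          g u - η ≤ ν * (Torus.eGradNormSq ((u : L2) : Vec3)).toReal + Torus.nsGeneratorPairing ν f u (Φ.grad u) +
            2 * θ * (Torus.pairing (u : L2) f - ν * (Torus.eGradNormSq ((u : L2) : Vec3)).toReal) := by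
  intro hS0 hS1 hS2 hS3a ν f hν hfs g hg hK η hη hrel
  obtain ⟨K, hK⟩ := hK
  by_contra hno
  choose μs hμs using fun n : ℕ => BudgetDuality.approxRelaxed hS0 hS1 hS2 hS3a hν hfs hg hK η n hno
  obtain ⟨μ, hball, hfin, hLiou, hW, hEI, hD⟩ :=
    BudgetDuality.penalisationLimit hS0 hS1 hS3a hν hfs hg hK η μs hμs
  have h := hrel (μ : Measure H3) inferInstance hball hfin hLiou hW hEI
  linarith

end Summit.AnomalousDissipation.AnomalousDissipation.Theorems.TaylorCertificatesFloorCertificateEnsembleCeiling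

end
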